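import Summits.QuantumFields.YangMills.Theorems.BalabanUVNodesN15KingModelPotentialDecay

/-!
# Route «BalabanUVNodes» (K4 «SpineRates»), node N15 = NE2 — THE KING-MODEL RUNG, part 9b: THE DRESSED LAPLACIAN IS LIPSCHITZ IN THE POTENTIAL AND ITS
# SECOND-ORDER TAYLOR REMAINDER IS LOCAL — King's `Δ_eff(w) = a − a²N^dQ(A₀ + w)⁻¹Qᵀ` for every `|w| ≤ w₁` (no first-order truncation), uniformly

Cell `pub-ymgap`, Track A (D-0062), seat `pub-ymgap-dag-n15-d` (R134 seat, strategy s3, gen 7).  `bears_on: R4∕N15`; `--supports` the K3‴ item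
`SpineGivenEndpointR13` (stmt-QuantumFields-19912).  COUNT-NEUTRAL; 0 `def`.  Imports part 9a (`…KingModelPotentialDecay`: `dressed_block_le`, `blkCut`, `ctC`).

WHAT THIS FILE PROVES (kernel; `a, m² ≥ 0`, `0 < κ ≤ 1`, gap `w₀ + (2d + a)κ² < γ_A`; `C = ctC a w₀ κ d`, `K = latticeConst d (κ∕2)`).
* §4 **`effLaplacianPot_lipschitz`**: for ALL potentials `w, w′ ≥ −w₀` with `sup|w − w′| ≤ δ`, every `N`, every torus, all unit sites,
  `|Δ_eff(w)(b,b′) − Δ_eff(w′)(b,b′)| ≤ a²C²K·δ·e^{−(κ∕2)·tdist(b,b′)}` — LIPSCHITZ IN THE POTENTIAL WITH DECAY.  Mechanism: the resolvent identity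
  `(A₀+w)⁻¹ − (A₀+w′)⁻¹ = (A₀+w)⁻¹diag(w′−w)(A₀+w′)⁻¹` (King's (4.37) device, tree `King1986.inv_sub_inv_of_isUnit`), the entry as the fine sum
  `Σ_x (G_wQ_b)(x)(w′−w)(x)(G_{w′}Q_{b′})(x)` (`sandwich_mul_diagonal_mul_apply`), Cauchy–Schwarz block by block (`abs_sum_mul_mul_le_blocks`), 9a's block
  norms for both dressed propagators, one lattice sum (`sum_blocks_exp_le`).  At `w′ = 0` this is the (3.35)-type LOCALITY LETTER OF THE FULL PERTURBATION
  `Δ_eff(w) − Δ^{(k)}` with constant `∝ sup|w|` — part 6b's `Reg335` slot `UniformKernelDecay E …` DERIVED for the nonperturbatively dressed operator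
  (parts 8a–8c had it for the first variation only).
* §5 **`effLaplacianPot_taylor2_le`**: for `|w| ≤ w₁`, `|Δ_eff(w)(b,b′) − Δ^{(k)}(b,b′) − δΔ[w](b,b′)| ≤ a²C³K²·w₁²·e^{−(κ∕2)·tdist(b,b′)}` where
  `δΔ[w] = a²N^d·(Q A₀⁻¹diag(w)A₀⁻¹ Qᵀ)(b,b′) = N^{−d}Σ_zψ_b(z)w(z)ψ_{b′}(z)` is part 8d's first variation (`sandwich_minimiser_eq`,
  `hasDerivAt_effLaplacianPot_apply`) — THE SECOND-ORDER TAYLOR REMAINDER IS `O(w₁²)` AND EXPONENTIALLY LOCAL (exact second-order resolvent expansion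
  `G_w = G₀ − G₀wG₀ + G₀wG₀wG_w`, `inv_taylor2_eq`; a double lattice sum `sum2_blocks_exp_le`).  This quantifies the honest scope of parts 8a–8e: the
  first-order dressing `Δ^{(k)} + E(v)` IS the full dressing `Δ^{(k)}_v` up to a LOCAL `O(sup|v|²)` (`…_taylor2_minimiser_le`: the `ψwψ` form).

HONEST FRAMING ∕ LIMITS.  King's `A = 0` SCALAR block-spin construction (periodic b.c., flat blocks); a potential is NOT a gauge field; nothing here is
Bałaban's `Δ^{(k)}(U) − Δ^{(k)}(1)`, `G(U)`, `C^{(k)}(Λ;U)` (η-differences NOT PRINTED); the TWO-SPACING RATE letter (H3) of the full dressed tower is NOT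
proved (first-order only, parts 8a∕8b; nonperturbatively it needs the `A = 0` instance of King's Prop. 3.9, not in the tree); NOT a node discharge;
typed 28∕28, discharged count untouched; one finite torus at fixed ε — NOT ℝ⁴ ∕ infinite volume ∕ OS ∕ mass gap ∕ Clay.  Locators: [King1986] = C. King,
CMP **102** (1986) 649–677: (2.13)–(2.15) p. 653, (4.34), (4.37)–(4.38) p. 674; [Dimock2013] = J. Dimock, Rev. Math. Phys. **25** (2013) 1330010, App. D L. 29–30.
-/

noncomputable section

open scoped BigOperators Matrix
open Finset

namespace Summit.QuantumFields.YangMills.BalabanUVNodes.N15.KingModel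

open Literature.MathematicalPhysics.QuantumFieldTheory.Balaban1983to89 hiding blockOf
open Literature.MathematicalPhysics.QuantumFieldTheory.Balaban1983to89.QGQInverse (Coercive isUnit_of_coercive)
open Literature.MathematicalPhysics.QuantumFieldTheory.Balaban1983to89.B4Sect5Proof (latticeConst latticeConst_nonneg)
open Literature.MathematicalPhysics.QuantumFieldTheory.Balaban1983to89.B5Prop11Plancherel (Tor fine)
open Literature.MathematicalPhysics.QuantumFieldTheory.King1986 (inv_sub_inv_of_isUnit)
open Literature.MathematicalPhysics.QuantumFieldTheory.King1986.Torus

variable {d : ℕ}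
/-! ## §4 Lipschitz dependence on the potential, WITH decay -/

section Lipschitz

variable {N : ℕ} [NeZero N] {U : Fin (d + 1) → ℕ} [∀ μ, NeZero (U μ)] {a m2 : ℝ}

/-- The entry of a sandwich `Q·(G·diag(u)·G′)·Qᵀ` with `G` symmetric is the fine-lattice sum `Σ_x (G Q_b)(x)·u(x)·(G′ Q_{b′})(x)`. [folklore] -/
theorem sandwich_mul_diagonal_mul_apply (G G' : Matrix (Tor (fine N U)) (Tor (fine N U)) ℝ) (hG : ∀ x y, G y x = G x y)
    (u : Tor (fine N U) → ℝ) (b b' : Tor U) :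
    (Qmat N U * (G * Matrix.diagonal u * G') * (Qmat N U)ᵀ) b b'
      = ∑ x, (G *ᵥ fun y => Qmat N U b y) x * u x * (G' *ᵥ fun y => Qmat N U b' y) x := by
  have e : Qmat N U * (G * Matrix.diagonal u * G') * (Qmat N U)ᵀ = (Qmat N U * G) * Matrix.diagonal u * (G' * (Qmat N U)ᵀ) := by
    simp only [Matrix.mul_assoc]
  rw [e, Matrix.mul_apply]
  refine sum_congr rfl fun x _ => ?_
  rw [Matrix.mul_diagonal, Matrix.mul_apply, Matrix.mul_apply]
  simp only [Matrix.mulVec, dotProduct, Matrix.transpose_apply]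
  rw [sum_congr rfl fun y _ => show Qmat N U b y * G y x = G x y * Qmat N U b y by rw [hG x y, mul_comm]]

/-- **Cauchy–Schwarz block by block**: `|Σ_x u(x)δ(x)v(x)| ≤ sup|δ| · Σ_z ‖1_{B(z)}u‖·‖1_{B(z)}v‖`. [folklore] -/
theorem abs_sum_mul_mul_le_blocks (u v δ : Tor (fine N U) → ℝ) {δ₀ : ℝ} (hδ : ∀ x, |δ x| ≤ δ₀) :
    |∑ x, u x * δ x * v x| ≤ δ₀ * ∑ z : Tor U, Real.sqrt (blkCut z u ⬝ᵥ blkCut z u) * Real.sqrt (blkCut z v ⬝ᵥ blkCut z v) := by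
  have hδ0 : 0 ≤ δ₀ := (abs_nonneg _).trans (hδ 0)
  rw [sum_fine_eq_sum_blocks N U, mul_sum]
  refine (abs_sum_le_sum_abs _ _).trans (sum_le_sum fun z _ => ?_)
  have h1 : |∑ j : Fin (d + 1) → Fin N, u (site N U z j) * δ (site N U z j) * v (site N U z j)|
      ≤ δ₀ * ∑ j : Fin (d + 1) → Fin N, |u (site N U z j)| * |v (site N U z j)| := by
    rw [mul_sum]
    refine (abs_sum_le_sum_abs _ _).trans (sum_le_sum fun j _ => ?_)
    rw [abs_mul, abs_mul]
    calc |u (site N U z j)| * |δ (site N U z j)| * |v (site N U z j)| ≤ |u (site N U z j)| * δ₀ * |v (site N U z j)| := by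
          gcongr; exact hδ _
      _ = δ₀ * (|u (site N U z j)| * |v (site N U z j)|) := by ring
  have hcs := sum_mul_sq_le_sq_mul_sq (univ : Finset (Fin (d + 1) → Fin N)) (fun j => |u (site N U z j)|) (fun j => |v (site N U z j)|)
  simp only [sq_abs] at hcs
  have hs0 : 0 ≤ ∑ j : Fin (d + 1) → Fin N, |u (site N U z j)| * |v (site N U z j)| := sum_nonneg fun j _ => by positivity
  have h2 : ∑ j : Fin (d + 1) → Fin N, |u (site N U z j)| * |v (site N U z j)|
      ≤ Real.sqrt (∑ j : Fin (d + 1) → Fin N, u (site N U z j) ^ 2) * Real.sqrt (∑ j : Fin (d + 1) → Fin N, v (site N U z j) ^ 2) := by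
    rw [← Real.sqrt_mul (sum_nonneg fun j _ => sq_nonneg _), ← Real.sqrt_sq hs0]
    exact Real.sqrt_le_sqrt hcs
  rw [blkCut_dot_self, blkCut_dot_self]
  exact h1.trans (mul_le_mul_of_nonneg_left h2 hδ0)

/-- **One lattice sum**: `Σ_z e^{−κ tdist(z,b)}e^{−κ tdist(z,b′)} ≤ K_d(κ∕2)·e^{−(κ∕2)tdist(b,b′)}` (triangle inequality + `UniformDecay.tdistT_sumBound`). [folklore] -/
theorem sum_blocks_exp_le {κ : ℝ} (hκ : 0 < κ) (b b' : Tor U) :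
    ∑ z : Tor U, Real.exp (-(κ * tdistT U z b)) * Real.exp (-(κ * tdistT U z b'))
      ≤ latticeConst (d + 1) (κ / 2) * Real.exp (-(κ / 2 * tdistT U b b')) := by
  have hterm : ∀ z : Tor U, Real.exp (-(κ * tdistT U z b)) * Real.exp (-(κ * tdistT U z b'))
      ≤ Real.exp (-(κ / 2 * tdistT U b z)) * Real.exp (-(κ / 2 * tdistT U b b')) := by
    intro z
    rw [← Real.exp_add, ← Real.exp_add]
    apply Real.exp_le_exp.mpr
    have htri := tdistT_triangle U b z b'
    have hsymm := tdistT_symm U z b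
    have h1 : κ / 2 * tdistT U b b' ≤ κ / 2 * tdistT U b z + κ / 2 * tdistT U z b' := by
      have := mul_le_mul_of_nonneg_left htri (half_pos hκ).le; linarith
    have h2 : 0 ≤ κ / 2 * tdistT U z b' := mul_nonneg (half_pos hκ).le (tdistT_nonneg U z b')
    have h3 : 0 ≤ κ / 2 * tdistT U b z := mul_nonneg (half_pos hκ).le (tdistT_nonneg U b z)
    rw [hsymm]
    linarith
  calc ∑ z : Tor U, Real.exp (-(κ * tdistT U z b)) * Real.exp (-(κ * tdistT U z b'))
      ≤ ∑ z : Tor U, Real.exp (-(κ / 2 * tdistT U b z)) * Real.exp (-(κ / 2 * tdistT U b b')) := sum_le_sum fun z _ => hterm z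
    _ = (∑ z : Tor U, Real.exp (-(κ / 2 * tdistT U b z))) * Real.exp (-(κ / 2 * tdistT U b b')) := by rw [sum_mul]
    _ ≤ latticeConst (d + 1) (κ / 2) * Real.exp (-(κ / 2 * tdistT U b b')) :=
        mul_le_mul_of_nonneg_right (tdistT_sumBound U (κ / 2) (half_pos hκ) b) (Real.exp_pos _).le

/-- **THE DRESSED EFFECTIVE LAPLACIAN IS LIPSCHITZ IN THE POTENTIAL, WITH EXPONENTIAL DECAY.**  For `a ≥ 0`, `m² ≥ 0`, `0 < κ ≤ 1`, `w₀ ≥ 0` with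
`w₀ + (2d + a)κ² < γ_A`, ALL potentials `w, w′ ≥ −w₀` with `sup|w − w′| ≤ δ`, every `N`, every torus and all unit sites:
`|Δ_eff(w)(b,b′) − Δ_eff(w′)(b,b′)| ≤ a²·C²·K_d(κ∕2)·δ·e^{−(κ∕2)·tdist(b,b′)}`  (`C = ctC a w₀ κ d`, `K_d = latticeConst`).  Mechanism: resolvent identity
`(A₀+w)⁻¹ − (A₀+w′)⁻¹ = (A₀+w)⁻¹diag(w′−w)(A₀+w′)⁻¹` (King's (4.37) device), the entry as a fine sum, Cauchy–Schwarz block by block, Lemma 30 in block-norm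
form for both dressed propagators, one lattice sum.  At `w′ = 0`: the (3.35)-type locality letter of the FULL perturbation `Δ_eff(w) − Δ^{(k)}` with
constant `∝ sup|w|`. [cite: King1986, (4.37)–(4.38) p.674 (resolvent identity device), (4.34) p.674; Dimock2013, App. D, Lemma 30] -/
theorem effLaplacianPot_lipschitz (ha : 0 ≤ a) (hm : 0 ≤ m2) {κ w₀ : ℝ} (hκ0 : 0 < κ) (hκ1 : κ ≤ 1)
    (hgap : w₀ + (2 * ((d + 1 : ℕ) : ℝ) + a) * κ ^ 2 < gamA a (d + 1)) {w w' : Tor (fine N U) → ℝ} (hw : ∀ x, -w₀ ≤ w x)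
    (hw' : ∀ x, -w₀ ≤ w' x) {δ : ℝ} (hδ : ∀ x, |w x - w' x| ≤ δ) (b b' : Tor U) :
    |effLaplacianPot N U a ((N : ℝ) ^ 2) m2 w b b' - effLaplacianPot N U a ((N : ℝ) ^ 2) m2 w' b b'|
      ≤ a ^ 2 * ctC a w₀ κ (d + 1) ^ 2 * latticeConst (d + 1) (κ / 2) * δ * Real.exp (-(κ / 2 * tdistT U b b')) := by
  set A := fineOpPot N U a ((N : ℝ) ^ 2) m2 w with hA
  set A' := fineOpPot N U a ((N : ℝ) ^ 2) m2 w' with hA'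
  set C := ctC a w₀ κ (d + 1) with hC
  have hC0 : 0 ≤ C := ctC_nonneg (by exact_mod_cast hgap)
  have hNr : (0 : ℝ) < ((N : ℕ) : ℝ) ^ (d + 1) := pow_pos (Nat.cast_pos.mpr (Nat.pos_of_ne_zero (NeZero.ne N))) _
  have hw₀γ : w₀ < gamA a (d + 1) := by
    have : 0 ≤ (2 * ((d + 1 : ℕ) : ℝ) + a) * κ ^ 2 := by positivity
    linarith
  have hU : IsUnit A := fineOpPot_isUnit ha hm hw hw₀γ
  have hU' : IsUnit A' := fineOpPot_isUnit ha hm hw' hw₀γ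
  -- resolvent identity and the entry as a fine sum
  have hres : A⁻¹ - A'⁻¹ = A⁻¹ * Matrix.diagonal (w' - w) * A'⁻¹ := by
    rw [inv_sub_inv_of_isUnit A A' hU hU', hA, hA', fineOpPot_sub_fineOpPot]
  have hdiff : effLaplacianPot N U a ((N : ℝ) ^ 2) m2 w b b' - effLaplacianPot N U a ((N : ℝ) ^ 2) m2 w' b b'
      = -(a ^ 2 * (N : ℝ) ^ (d + 1)) * (Qmat N U * (A⁻¹ * Matrix.diagonal (w' - w) * A'⁻¹) * (Qmat N U)ᵀ) b b' := by
    rw [← hres, Matrix.mul_sub, Matrix.sub_mul, Matrix.sub_apply, effLaplacianPot, effLaplacianPot]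
    simp only [Matrix.sub_apply, Matrix.smul_apply, smul_eq_mul, ← hA, ← hA']
    ring
  rw [hdiff, sandwich_mul_diagonal_mul_apply _ _ (fineOpPot_inv_symm _ w), abs_mul, abs_neg,
    abs_of_nonneg (by positivity : (0 : ℝ) ≤ a ^ 2 * (N : ℝ) ^ (d + 1))]
  -- block-by-block Cauchy–Schwarz and the two block norms
  have hδ' : ∀ x, |(w' - w) x| ≤ δ := fun x => by rw [Pi.sub_apply, abs_sub_comm]; exact hδ x
  have hblocks := abs_sum_mul_mul_le_blocks (A⁻¹ *ᵥ fun y => Qmat N U b y) (A'⁻¹ *ᵥ fun y => Qmat N U b' y) (w' - w) hδ'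
  have hu : ∀ z : Tor U, Real.sqrt (blkCut z (A⁻¹ *ᵥ fun y => Qmat N U b y) ⬝ᵥ blkCut z (A⁻¹ *ᵥ fun y => Qmat N U b y))
      ≤ C * Real.exp (-(κ * tdistT U z b)) * Real.sqrt ((((N : ℕ) : ℝ) ^ (d + 1))⁻¹) := fun z => by
    rw [← Qrow_dot_self (N := N) b]
    exact dressed_blockNorm_le ha hm hκ0.le hκ1 hgap hw z (fun x hx => Qrow_eq_zero_of_ne b hx)
  have hv : ∀ z : Tor U, Real.sqrt (blkCut z (A'⁻¹ *ᵥ fun y => Qmat N U b' y) ⬝ᵥ blkCut z (A'⁻¹ *ᵥ fun y => Qmat N U b' y))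
      ≤ C * Real.exp (-(κ * tdistT U z b')) * Real.sqrt ((((N : ℕ) : ℝ) ^ (d + 1))⁻¹) := fun z => by
    rw [← Qrow_dot_self (N := N) b']
    exact dressed_blockNorm_le ha hm hκ0.le hκ1 hgap hw' z (fun x hx => Qrow_eq_zero_of_ne b' hx)
  set s := Real.sqrt ((((N : ℕ) : ℝ) ^ (d + 1))⁻¹) with hs
  have hsq : s * s = ((((N : ℕ) : ℝ) ^ (d + 1))⁻¹) := Real.mul_self_sqrt (by positivity)
  have hsum : ∑ z : Tor U, Real.sqrt (blkCut z (A⁻¹ *ᵥ fun y => Qmat N U b y) ⬝ᵥ blkCut z (A⁻¹ *ᵥ fun y => Qmat N U b y))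
        * Real.sqrt (blkCut z (A'⁻¹ *ᵥ fun y => Qmat N U b' y) ⬝ᵥ blkCut z (A'⁻¹ *ᵥ fun y => Qmat N U b' y))
      ≤ C ^ 2 * ((((N : ℕ) : ℝ) ^ (d + 1))⁻¹) * (latticeConst (d + 1) (κ / 2) * Real.exp (-(κ / 2 * tdistT U b b'))) := by
    calc _ ≤ ∑ z : Tor U, (C * Real.exp (-(κ * tdistT U z b)) * s) * (C * Real.exp (-(κ * tdistT U z b')) * s) :=
          sum_le_sum fun z _ => mul_le_mul (hu z) (hv z) (Real.sqrt_nonneg _) (by positivity)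
      _ = C ^ 2 * ((((N : ℕ) : ℝ) ^ (d + 1))⁻¹) * ∑ z : Tor U, Real.exp (-(κ * tdistT U z b)) * Real.exp (-(κ * tdistT U z b')) := by
          rw [mul_sum]; refine sum_congr rfl fun z _ => ?_; rw [← hsq]; ring
      _ ≤ _ := mul_le_mul_of_nonneg_left (sum_blocks_exp_le hκ0 b b') (by positivity)
  have hδ0 : 0 ≤ δ := (abs_nonneg _).trans (hδ (site N U b (j0 N)))
  calc a ^ 2 * (N : ℝ) ^ (d + 1) * |∑ x, (A⁻¹ *ᵥ fun y => Qmat N U b y) x * (w' - w) x * (A'⁻¹ *ᵥ fun y => Qmat N U b' y) x|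
      ≤ a ^ 2 * (N : ℝ) ^ (d + 1) * (δ * (C ^ 2 * ((((N : ℕ) : ℝ) ^ (d + 1))⁻¹)
          * (latticeConst (d + 1) (κ / 2) * Real.exp (-(κ / 2 * tdistT U b b'))))) := by
        refine mul_le_mul_of_nonneg_left (hblocks.trans (mul_le_mul_of_nonneg_left hsum hδ0)) (by positivity)
    _ = _ := by field_simp

end Lipschitz

/-! ## §5 The second-order Taylor remainder in the potential, WITH decay -/

section Taylor

variable {N : ℕ} [NeZero N] {U : Fin (d + 1) → ℕ} [∀ μ, NeZero (U μ)] {a m2 : ℝ}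

/-- The block cut-offs of a vector sum to the vector (every fine point lies in exactly one block). [folklore] -/
theorem sum_blkCut (v : Tor (fine N U) → ℝ) : ∑ z : Tor U, blkCut z v = v := by
  funext x
  rw [Finset.sum_apply]
  simp only [blkCut]
  rw [Finset.sum_ite_eq]
  simp

/-- A block cut-off paired with any vector is the sum over that block. [folklore] -/
theorem blkCut_dotProduct (z : Tor U) (p g : Tor (fine N U) → ℝ) :
    blkCut z p ⬝ᵥ g = ∑ j : Fin (d + 1) → Fin N, p (site N U z j) * g (site N U z j) := by
  unfold dotProduct
  rw [sum_fine_eq_sum_blocks N U]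
  have h : ∀ z' : Tor U, ∑ j : Fin (d + 1) → Fin N, blkCut z p (site N U z' j) * g (site N U z' j)
      = if z' = z then ∑ j : Fin (d + 1) → Fin N, p (site N U z' j) * g (site N U z' j) else 0 := by
    intro z'
    by_cases hz : z' = z
    · rw [if_pos hz]
      exact sum_congr rfl fun j _ => by unfold blkCut; rw [blockOf_site, if_pos hz]
    · rw [if_neg hz]
      exact sum_eq_zero fun j _ => by unfold blkCut; rw [blockOf_site, if_neg hz, zero_mul]
  rw [sum_congr rfl fun z' _ => h z', sum_ite_eq' univ z, if_pos (mem_univ z)]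

/-- Pointwise domination `|p| ≤ w₁|u|` passes to the block norms: `‖1_{B(z)}p‖ ≤ w₁‖1_{B(z)}u‖`. [folklore] -/
theorem blkCut_norm_le_of_abs_le (z : Tor U) {p u : Tor (fine N U) → ℝ} {w₁ : ℝ} (hw₁ : 0 ≤ w₁) (h : ∀ x, |p x| ≤ w₁ * |u x|) :
    Real.sqrt (blkCut z p ⬝ᵥ blkCut z p) ≤ w₁ * Real.sqrt (blkCut z u ⬝ᵥ blkCut z u) := by
  rw [blkCut_dot_self, blkCut_dot_self]
  have hle : ∑ j : Fin (d + 1) → Fin N, p (site N U z j) ^ 2 ≤ w₁ ^ 2 * ∑ j : Fin (d + 1) → Fin N, u (site N U z j) ^ 2 := by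
    rw [mul_sum]
    refine sum_le_sum fun j _ => ?_
    have h1 := h (site N U z j)
    have h2 : |p (site N U z j)| ^ 2 ≤ (w₁ * |u (site N U z j)|) ^ 2 := pow_le_pow_left₀ (abs_nonneg _) h1 2
    rw [sq_abs, mul_pow, sq_abs] at h2
    exact h2
  calc Real.sqrt (∑ j : Fin (d + 1) → Fin N, p (site N U z j) ^ 2)
      ≤ Real.sqrt (w₁ ^ 2 * ∑ j : Fin (d + 1) → Fin N, u (site N U z j) ^ 2) := Real.sqrt_le_sqrt hle
    _ = w₁ * Real.sqrt (∑ j : Fin (d + 1) → Fin N, u (site N U z j) ^ 2) := by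
        rw [Real.sqrt_mul (sq_nonneg _), Real.sqrt_sq hw₁]

/-- **The exact second-order resolvent expansion**: `(A₀ + w)⁻¹ = A₀⁻¹ − A₀⁻¹wA₀⁻¹ + A₀⁻¹wA₀⁻¹w(A₀ + w)⁻¹`. [cite: King1986, (4.37)–(4.38) p.674 (iterated resolvent identity)] -/
theorem inv_taylor2_eq (c : ℝ) (w : Tor (fine N U) → ℝ) (h0 : IsUnit (fineOpPot N U a c m2 0)) (hw : IsUnit (fineOpPot N U a c m2 w)) :
    (fineOpPot N U a c m2 w)⁻¹
      = (fineOpPot N U a c m2 0)⁻¹ - (fineOpPot N U a c m2 0)⁻¹ * Matrix.diagonal w * (fineOpPot N U a c m2 0)⁻¹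
        + (fineOpPot N U a c m2 0)⁻¹ * Matrix.diagonal w * (fineOpPot N U a c m2 0)⁻¹ * Matrix.diagonal w * (fineOpPot N U a c m2 w)⁻¹ := by
  set A := fineOpPot N U a c m2 w with hA
  set A0 := fineOpPot N U a c m2 0 with hA0
  set D := Matrix.diagonal w with hD
  have h1 : A0⁻¹ - A⁻¹ = A0⁻¹ * D * A⁻¹ := by
    rw [inv_sub_inv_of_isUnit A0 A h0 hw, hA, hA0, fineOpPot_sub_fineOpPot, sub_zero]
  have h2 : A⁻¹ = A0⁻¹ - A0⁻¹ * D * A⁻¹ := by rw [← h1]; abel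
  have h3 : A0⁻¹ * D * A⁻¹ = A0⁻¹ * D * (A0⁻¹ - A0⁻¹ * D * A⁻¹) := by rw [← h2]
  calc A⁻¹ = A0⁻¹ - A0⁻¹ * D * A⁻¹ := h2
    _ = A0⁻¹ - A0⁻¹ * D * (A0⁻¹ - A0⁻¹ * D * A⁻¹) := by rw [← h3]
    _ = A0⁻¹ - A0⁻¹ * D * A0⁻¹ + A0⁻¹ * D * A0⁻¹ * D * A⁻¹ := by
        rw [Matrix.mul_sub]; simp only [Matrix.mul_assoc]; abel

/-- **A double lattice sum**: `Σ_{z,z′} e^{−κ t(z,b)}e^{−κ t(z,z′)}e^{−κ t(z′,b′)} ≤ K_d(κ∕2)²·e^{−(κ∕2)t(b,b′)}` (the chain `b–z–z′–b′`, triangle inequality,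
`UniformDecay.tdistT_sumBound` twice). [folklore] -/
theorem sum2_blocks_exp_le {κ : ℝ} (hκ : 0 < κ) (b b' : Tor U) :
    ∑ z : Tor U, ∑ z' : Tor U, Real.exp (-(κ * tdistT U z b)) * Real.exp (-(κ * tdistT U z z')) * Real.exp (-(κ * tdistT U z' b'))
      ≤ latticeConst (d + 1) (κ / 2) ^ 2 * Real.exp (-(κ / 2 * tdistT U b b')) := by
  have hK := tdistT_sumBound U (κ / 2) (half_pos hκ)
  have hterm : ∀ z z' : Tor U, Real.exp (-(κ * tdistT U z b)) * Real.exp (-(κ * tdistT U z z')) * Real.exp (-(κ * tdistT U z' b'))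
      ≤ Real.exp (-(κ / 2 * tdistT U b b')) * (Real.exp (-(κ / 2 * tdistT U b z)) * Real.exp (-(κ / 2 * tdistT U z z'))) := by
    intro z z'
    rw [← Real.exp_add, ← Real.exp_add, ← Real.exp_add, ← Real.exp_add]
    apply Real.exp_le_exp.mpr
    have h1 := tdistT_triangle U b z b'
    have h2 := tdistT_triangle U z z' b'
    have hs := tdistT_symm U z b
    have n1 := tdistT_nonneg U b z
    have n2 := tdistT_nonneg U z z'
    have n3 := tdistT_nonneg U z' b'
    have hκ2 : 0 < κ / 2 := half_pos hκ
    rw [hs]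
    nlinarith [mul_le_mul_of_nonneg_left h1 hκ2.le, mul_le_mul_of_nonneg_left h2 hκ2.le, mul_nonneg hκ2.le n1, mul_nonneg hκ2.le n2,
      mul_nonneg hκ2.le n3]
  calc _ ≤ ∑ z : Tor U, ∑ z' : Tor U, Real.exp (-(κ / 2 * tdistT U b b')) * (Real.exp (-(κ / 2 * tdistT U b z)) * Real.exp (-(κ / 2 * tdistT U z z'))) :=
        sum_le_sum fun z _ => sum_le_sum fun z' _ => hterm z z'
    _ = Real.exp (-(κ / 2 * tdistT U b b')) * ∑ z : Tor U, Real.exp (-(κ / 2 * tdistT U b z)) * ∑ z' : Tor U, Real.exp (-(κ / 2 * tdistT U z z')) := by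
        simp only [mul_sum]
    _ ≤ Real.exp (-(κ / 2 * tdistT U b b')) * ∑ z : Tor U, Real.exp (-(κ / 2 * tdistT U b z)) * latticeConst (d + 1) (κ / 2) := by
        refine mul_le_mul_of_nonneg_left (sum_le_sum fun z _ => ?_) (Real.exp_pos _).le
        exact mul_le_mul_of_nonneg_left (hK z) (Real.exp_pos _).le
    _ ≤ Real.exp (-(κ / 2 * tdistT U b b')) * (latticeConst (d + 1) (κ / 2) * latticeConst (d + 1) (κ / 2)) := by
        rw [← sum_mul]
        refine mul_le_mul_of_nonneg_left ?_ (Real.exp_pos _).le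
        exact mul_le_mul_of_nonneg_right (hK b) (latticeConst_nonneg (d + 1) (half_pos hκ).le)
    _ = _ := by ring

/-- **THE SECOND-ORDER TAYLOR REMAINDER OF THE DRESSED EFFECTIVE LAPLACIAN IS `O(w₁²)` AND EXPONENTIALLY LOCAL.**  For `a, m² ≥ 0`, `0 < κ ≤ 1`,
`w₁ + (2d + a)κ² < γ_A`, EVERY potential with `|w| ≤ w₁`, every `N`, every torus and all unit sites:
`|Δ_eff(w)(b,b′) − Δ_eff(0)(b,b′) − a²N^d·(Q A₀⁻¹ diag(w) A₀⁻¹ Qᵀ)(b,b′)| ≤ a²·C³·K²·w₁²·e^{−(κ∕2)·tdist(b,b′)}` (`C = ctC a w₁ κ d`, `K = K_d(κ∕2)`); the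
subtracted first-order term is part 8d's first variation `N^{−d}Σ_zψ_b(z)w(z)ψ_{b′}(z)` (`sandwich_minimiser_eq`).  Mechanism: `inv_taylor2_eq`, the remainder
entry as `⟨(G₀Q_b)·w, G₀(w·G_wQ_{b′})⟩`, block decomposition of both vectors (`sum_blkCut`), 9a's `dressed_block_le` between blocks and `dressed_blockNorm_le`
for the outer factors, the double lattice sum. [cite: King1986, (2.13)–(2.15) p.653, (4.34), (4.37)–(4.38) p.674; Dimock2013, App. D, Lemma 30] -/
theorem effLaplacianPot_taylor2_le (ha : 0 ≤ a) (hm : 0 ≤ m2) {κ w₁ : ℝ} (hκ0 : 0 < κ) (hκ1 : κ ≤ 1)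
    (hgap : w₁ + (2 * ((d + 1 : ℕ) : ℝ) + a) * κ ^ 2 < gamA a (d + 1)) {w : Tor (fine N U) → ℝ} (hw : ∀ x, |w x| ≤ w₁) (b b' : Tor U) :
    |effLaplacianPot N U a ((N : ℝ) ^ 2) m2 w b b' - effLaplacianPot N U a ((N : ℝ) ^ 2) m2 0 b b'
        - (a ^ 2 * (N : ℝ) ^ (d + 1)) * (Qmat N U * ((fineOpPot N U a ((N : ℝ) ^ 2) m2 0)⁻¹ * Matrix.diagonal w
            * (fineOpPot N U a ((N : ℝ) ^ 2) m2 0)⁻¹) * (Qmat N U)ᵀ) b b'|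
      ≤ a ^ 2 * ctC a w₁ κ (d + 1) ^ 3 * latticeConst (d + 1) (κ / 2) ^ 2 * w₁ ^ 2 * Real.exp (-(κ / 2 * tdistT U b b')) := by
  set A := fineOpPot N U a ((N : ℝ) ^ 2) m2 w with hA
  set A0 := fineOpPot N U a ((N : ℝ) ^ 2) m2 0 with hA0
  set D := Matrix.diagonal w with hD
  set C := ctC a w₁ κ (d + 1) with hC
  set K := latticeConst (d + 1) (κ / 2) with hK
  have hC0 : 0 ≤ C := ctC_nonneg (by exact_mod_cast hgap)
  have hK0 : 0 ≤ K := latticeConst_nonneg (d + 1) (half_pos hκ0).le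
  have hNr : (0 : ℝ) < ((N : ℕ) : ℝ) ^ (d + 1) := pow_pos (Nat.cast_pos.mpr (Nat.pos_of_ne_zero (NeZero.ne N))) _
  have hw₁0 : 0 ≤ w₁ := (abs_nonneg _).trans (hw (site N U b (j0 N)))
  have hwlo : ∀ x, -w₁ ≤ w x := fun x => (abs_le.mp (hw x)).1
  have h0lo : ∀ x, -w₁ ≤ (0 : Tor (fine N U) → ℝ) x := fun x => by rw [Pi.zero_apply]; linarith
  have hw₁γ : w₁ < gamA a (d + 1) := by
    have : 0 ≤ (2 * ((d + 1 : ℕ) : ℝ) + a) * κ ^ 2 := by positivity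
    linarith
  have hU : IsUnit A := fineOpPot_isUnit ha hm hwlo hw₁γ
  have hU0 : IsUnit A0 := fineOpPot_isUnit ha hm h0lo hw₁γ
  -- the remainder in matrix form
  have htaylor := inv_taylor2_eq ((N : ℝ) ^ 2) w hU0 hU
  rw [← hA, ← hA0, ← hD] at htaylor
  have hQ : (Qmat N U * A⁻¹ * (Qmat N U)ᵀ) b b' = (Qmat N U * A0⁻¹ * (Qmat N U)ᵀ) b b' - (Qmat N U * (A0⁻¹ * D * A0⁻¹) * (Qmat N U)ᵀ) b b'
      + (Qmat N U * (A0⁻¹ * D * A0⁻¹ * D * A⁻¹) * (Qmat N U)ᵀ) b b' := by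
    conv_lhs => rw [htaylor]
    simp only [Matrix.mul_add, Matrix.mul_sub, Matrix.add_mul, Matrix.sub_mul, Matrix.add_apply, Matrix.sub_apply, Matrix.mul_assoc]
  have hdiff : effLaplacianPot N U a ((N : ℝ) ^ 2) m2 w b b' - effLaplacianPot N U a ((N : ℝ) ^ 2) m2 0 b b'
        - (a ^ 2 * (N : ℝ) ^ (d + 1)) * (Qmat N U * (A0⁻¹ * D * A0⁻¹) * (Qmat N U)ᵀ) b b'
      = -(a ^ 2 * (N : ℝ) ^ (d + 1)) * (Qmat N U * (A0⁻¹ * D * A0⁻¹ * D * A⁻¹) * (Qmat N U)ᵀ) b b' := by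
    rw [effLaplacianPot, effLaplacianPot]
    simp only [Matrix.sub_apply, Matrix.smul_apply, smul_eq_mul, ← hA, ← hA0]
    rw [hQ]; ring
  rw [hdiff, abs_mul, abs_neg, abs_of_nonneg (by positivity : (0 : ℝ) ≤ a ^ 2 * (N : ℝ) ^ (d + 1))]
  -- the remainder entry as a pairing `⟨p, A0⁻¹ h⟩`
  set u : Tor (fine N U) → ℝ := A0⁻¹ *ᵥ fun y => Qmat N U b y with hu
  set v : Tor (fine N U) → ℝ := A⁻¹ *ᵥ fun y => Qmat N U b' y with hv
  set p : Tor (fine N U) → ℝ := fun x => u x * w x with hp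
  set h : Tor (fine N U) → ℝ := fun y => w y * v y with hh
  have hentry : (Qmat N U * (A0⁻¹ * D * A0⁻¹ * D * A⁻¹) * (Qmat N U)ᵀ) b b' = p ⬝ᵥ (A0⁻¹ *ᵥ h) := by
    have e1 : A0⁻¹ * D * A0⁻¹ * D * A⁻¹ = A0⁻¹ * Matrix.diagonal w * (A0⁻¹ * D * A⁻¹) := by rw [hD]; simp only [Matrix.mul_assoc]
    rw [e1, sandwich_mul_diagonal_mul_apply _ _ (fineOpPot_inv_symm _ 0)]
    have e2 : (A0⁻¹ * D * A⁻¹) *ᵥ (fun y => Qmat N U b' y) = A0⁻¹ *ᵥ h := by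
      rw [Matrix.mul_assoc, ← Matrix.mulVec_mulVec, ← Matrix.mulVec_mulVec]
      congr 1
      funext y
      rw [hh, hD, Matrix.mulVec_diagonal]
    rw [e2]
    rfl
  rw [hentry]
  -- block decomposition of both sides of the pairing
  have hdec : p ⬝ᵥ (A0⁻¹ *ᵥ h) = ∑ z' : Tor U, ∑ z : Tor U, blkCut z p ⬝ᵥ (A0⁻¹ *ᵥ blkCut z' h) := by
    conv_lhs => rw [← sum_blkCut h, Matrix.mulVec_sum, dotProduct_sum]
    refine sum_congr rfl fun z' _ => ?_
    conv_lhs => rw [← sum_blkCut p, sum_dotProduct]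
  rw [hdec]
  -- block norms of the outer factors
  set s := Real.sqrt ((((N : ℕ) : ℝ) ^ (d + 1))⁻¹) with hs
  have hsq : s * s = ((((N : ℕ) : ℝ) ^ (d + 1))⁻¹) := Real.mul_self_sqrt (by positivity)
  have hpu : ∀ x, |p x| ≤ w₁ * |u x| := fun x => by rw [hp]; dsimp only; rw [abs_mul, mul_comm]; exact mul_le_mul_of_nonneg_right (hw x) (abs_nonneg _)
  have hhv : ∀ x, |h x| ≤ w₁ * |v x| := fun x => by rw [hh]; dsimp only; rw [abs_mul]; exact mul_le_mul_of_nonneg_right (hw x) (abs_nonneg _)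
  have hnp : ∀ z : Tor U, Real.sqrt (blkCut z p ⬝ᵥ blkCut z p) ≤ w₁ * (C * Real.exp (-(κ * tdistT U z b)) * s) := fun z => by
    refine (blkCut_norm_le_of_abs_le z hw₁0 hpu).trans (mul_le_mul_of_nonneg_left ?_ hw₁0)
    rw [hs, ← Qrow_dot_self (N := N) b]
    exact dressed_blockNorm_le ha hm hκ0.le hκ1 hgap h0lo z (fun x hx => Qrow_eq_zero_of_ne b hx)
  have hnh : ∀ z' : Tor U, Real.sqrt (blkCut z' h ⬝ᵥ blkCut z' h) ≤ w₁ * (C * Real.exp (-(κ * tdistT U z' b')) * s) := fun z' => by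
    refine (blkCut_norm_le_of_abs_le z' hw₁0 hhv).trans (mul_le_mul_of_nonneg_left ?_ hw₁0)
    rw [hs, ← Qrow_dot_self (N := N) b']
    exact dressed_blockNorm_le ha hm hκ0.le hκ1 hgap hwlo z' (fun x hx => Qrow_eq_zero_of_ne b' hx)
  -- each block pair
  have hpair : ∀ z z' : Tor U, |blkCut z p ⬝ᵥ (A0⁻¹ *ᵥ blkCut z' h)|
      ≤ (C * Real.exp (-(κ * tdistT U z z'))) * (w₁ * (C * Real.exp (-(κ * tdistT U z b)) * s)) * (w₁ * (C * Real.exp (-(κ * tdistT U z' b')) * s)) := by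
    intro z z'
    have h1 := dressed_block_le ha hm hκ0.le hκ1 hgap h0lo (z := z) (z' := z') (f := blkCut z p) (g := blkCut z' h)
      (fun x hx => blkCut_of_ne hx) (fun x hx => blkCut_of_ne hx)
    rw [← hA0, ← hC] at h1
    have h2 : Real.sqrt (blkCut z p ⬝ᵥ blkCut z p) * Real.sqrt (blkCut z' h ⬝ᵥ blkCut z' h)
        ≤ (w₁ * (C * Real.exp (-(κ * tdistT U z b)) * s)) * (w₁ * (C * Real.exp (-(κ * tdistT U z' b')) * s)) :=
      mul_le_mul (hnp z) (hnh z') (Real.sqrt_nonneg _) (by positivity)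
    calc _ ≤ C * Real.exp (-(κ * tdistT U z z')) * Real.sqrt (blkCut z p ⬝ᵥ blkCut z p) * Real.sqrt (blkCut z' h ⬝ᵥ blkCut z' h) := h1
      _ = C * Real.exp (-(κ * tdistT U z z')) * (Real.sqrt (blkCut z p ⬝ᵥ blkCut z p) * Real.sqrt (blkCut z' h ⬝ᵥ blkCut z' h)) := by ring
      _ ≤ C * Real.exp (-(κ * tdistT U z z'))
          * ((w₁ * (C * Real.exp (-(κ * tdistT U z b)) * s)) * (w₁ * (C * Real.exp (-(κ * tdistT U z' b')) * s))) :=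
          mul_le_mul_of_nonneg_left h2 (by positivity)
      _ = _ := by ring
  have hsum : |∑ z' : Tor U, ∑ z : Tor U, blkCut z p ⬝ᵥ (A0⁻¹ *ᵥ blkCut z' h)|
      ≤ C ^ 3 * w₁ ^ 2 * ((((N : ℕ) : ℝ) ^ (d + 1))⁻¹) * (K ^ 2 * Real.exp (-(κ / 2 * tdistT U b b'))) := by
    calc _ ≤ ∑ z' : Tor U, |∑ z : Tor U, blkCut z p ⬝ᵥ (A0⁻¹ *ᵥ blkCut z' h)| := abs_sum_le_sum_abs _ _
      _ ≤ ∑ z' : Tor U, ∑ z : Tor U, |blkCut z p ⬝ᵥ (A0⁻¹ *ᵥ blkCut z' h)| := sum_le_sum fun z' _ => abs_sum_le_sum_abs _ _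
      _ ≤ ∑ z' : Tor U, ∑ z : Tor U, (C * Real.exp (-(κ * tdistT U z z'))) * (w₁ * (C * Real.exp (-(κ * tdistT U z b)) * s))
          * (w₁ * (C * Real.exp (-(κ * tdistT U z' b')) * s)) := sum_le_sum fun z' _ => sum_le_sum fun z _ => hpair z z'
      _ = C ^ 3 * w₁ ^ 2 * ((((N : ℕ) : ℝ) ^ (d + 1))⁻¹) * ∑ z : Tor U, ∑ z' : Tor U,
            Real.exp (-(κ * tdistT U z b)) * Real.exp (-(κ * tdistT U z z')) * Real.exp (-(κ * tdistT U z' b')) := by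
          rw [sum_comm, mul_sum]
          refine sum_congr rfl fun z _ => ?_
          rw [mul_sum]
          refine sum_congr rfl fun z' _ => ?_
          rw [← hsq]; ring
      _ ≤ _ := mul_le_mul_of_nonneg_left (sum2_blocks_exp_le hκ0 b b') (by positivity)
  calc a ^ 2 * (N : ℝ) ^ (d + 1) * |∑ z' : Tor U, ∑ z : Tor U, blkCut z p ⬝ᵥ (A0⁻¹ *ᵥ blkCut z' h)|
      ≤ a ^ 2 * (N : ℝ) ^ (d + 1) * (C ^ 3 * w₁ ^ 2 * ((((N : ℕ) : ℝ) ^ (d + 1))⁻¹) * (K ^ 2 * Real.exp (-(κ / 2 * tdistT U b b')))) :=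
        mul_le_mul_of_nonneg_left hsum (by positivity)
    _ = _ := by field_simp

/-- The same remainder bound with the first-order term written as King's `ψwψ` sandwich `N^{−d}Σ_z ψ_{δ_b}(z)w(z)ψ_{δ_{b′}}(z)` of part 8d
(`sandwich_minimiser_eq`; the derivative in `hasDerivAt_effLaplacianPot_apply`). [cite: King1986, (2.13)–(2.15) p.653, (4.34) p.674] -/
theorem effLaplacianPot_taylor2_minimiser_le (ha : 0 ≤ a) (hm : 0 ≤ m2) {κ w₁ : ℝ} (hκ0 : 0 < κ) (hκ1 : κ ≤ 1)
    (hgap : w₁ + (2 * ((d + 1 : ℕ) : ℝ) + a) * κ ^ 2 < gamA a (d + 1)) {w : Tor (fine N U) → ℝ} (hw : ∀ x, |w x| ≤ w₁) (b b' : Tor U) :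
    |effLaplacianPot N U a ((N : ℝ) ^ 2) m2 w b b' - effLaplacian N U a ((N : ℝ) ^ 2) m2 b b'
        - (((N : ℕ) : ℝ) ^ (d + 1))⁻¹ * ∑ z, minimiser N U a ((N : ℝ) ^ 2) m2 (Pi.single b 1) z * w z
            * minimiser N U a ((N : ℝ) ^ 2) m2 (Pi.single b' 1) z|
      ≤ a ^ 2 * ctC a w₁ κ (d + 1) ^ 3 * latticeConst (d + 1) (κ / 2) ^ 2 * w₁ ^ 2 * Real.exp (-(κ / 2 * tdistT U b b')) := by
  have h := effLaplacianPot_taylor2_le ha hm hκ0 hκ1 hgap hw b b'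
  have e0 : fineOpPot N U a ((N : ℝ) ^ 2) m2 0 = fineOp N U a ((N : ℝ) ^ 2) m2 := fineOpPot_zero
  have e1 : effLaplacianPot N U a ((N : ℝ) ^ 2) m2 0 = effLaplacian N U a ((N : ℝ) ^ 2) m2 := effLaplacianPot_zero
  rw [e0, e1, ← sandwich_minimiser_eq] at h
  exact h

end Taylor

end Summit.QuantumFields.YangMills.BalabanUVNodes.N15.KingModel

end
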